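import Summits.ResolutionOfSingularities.ResolutionOfSingularities.Theorems.PurelyInseparableDim4SwapTransportWindowStepSharpCorePrime
import HarnessLib
import HarnessLib.Audit.Tags

/-!
# Purely inseparable four-folds — THE ♯-VIRTUAL STEP FOR A REAL STEP OF ANY KIND, EVERY PRIME: one real step (slot step or rotation) of an
# isolated chain in regime, followed by one more, is shadowed by a PURE virtual slot step that keeps the ♯-frame (cell `res-dim4-pi`, K2(p)
# lane, rung-1 POWER-CONE LINE «light pair of TAIL(p, p−1, 3) ∀ p», flagless branch, FILE ♯7 part S♯ = W4/W5a §1 with the ♯-frame and the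
# look-ahead; seat res-dim4-typ-1 g6)

[OURS · counted 0 · cell `res-dim4-pi` · K2(p) lane (holder res-dim4-p-12 g5, rulings g5-23 / g5-27); res-dim4-p-3 g6's MEMO FLAGLESS♯ and
port plan §6, res-dim4-typ-1 g6's design note (bus 2026-08-29 14:20Z).]  Nothing here proves K2(p) for any `p`, any TAIL(p, p−1, 3),
FLAGLESS♯, `NoIsolatedTrap p p`, the Cossart–Jannsen–Saito theorem or resolution of singularities in dimension ≥ 4 / characteristic `p` —
NOT proved.  AI kernel work, weaker than expert review.  Transport bookkeeping about OUR frame; kills nothing by itself.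

**`virtual_step_sharp_any_prime`** — letters `λ μ | u f`, `d + 1 = p`, ROW `c` (`c + 3 ≤ d`), the pinning `hVT` BY VALUE (S♯a); relation `(π, A, B)` at precision `M`, real weights
`e_{πλ} + e_{πμ}`, the ♯-FRAME of `B` at jet `N ≥ d + 5` (order `d + 2`, `r = x_λx_μ ∣ F`, `resForm = a·x_f^d` and its support dress, exact
ledger, regime R in both slots, LAYER, dead row `(u, f) = (d − 3 − c, c)` below `N`, row ♯-flag `coeff_{x_λ³x_μ³x_u^{d−2−c}x_f^c} ≠ 0`, isolated,
`e_G = 3`); TWO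
honest real steps `A′ = step jr b A`, `A″ = step jr₂ b₂ A′`, both children isolated with certificate level `Nc`, of order `d + 2`, `e_G = 3`,
weights `≤ 1` of degree `2`, `x^r ∣ F`; budget `Nc + 3p + 2 ≤ M`.  THEN the virtual chart `ℓ ∈ {λ, μ}` and bijection `π′` of W5a's recursion
formulas shadow the FIRST real step by the PURE virtual step `step p univ ℓ 0 B`, related to `A′` along `π′` at precision `M − p`,
`A′.r = e_{π′λ} + e_{π′μ}`, and `step p univ ℓ 0 B` carries the ♯-frame at jet `N − d`.  ROUTE: C♯ `virtual_core_any_prime` (the translated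
shadow and its relation), then S♯a `virtual_step_sharp_of_core_prime` in the letters `(ℓ, other slot)` (look-ahead through the second real
step: the translation vanishes, the frame passes), the `μ`-case read back through `λ ↔ μ`.
[cite: Hauser2010, §§F–G] [cite: CossartJannsenSaito2020, Thm. 3.14, Lemma 13.2]
bears_on: LADDER-RESOLUTION:D157-DOOR2 (res-dim4-pi · K2(p) · power cones · flagless branch ♯7 ♯-virtual step of any kind).  Supports
stmt-ResolutionOfSingularities-16155 (helper).
-/

set_option linter.dupNamespace false -- mandated namespace of this single-conjunct summit

noncomputable section

namespace Summit.ResolutionOfSingularities.ResolutionOfSingularities.Theorems.PIDim4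

namespace SwapTransport

open MvPolynomial Finset
open Literature.AlgebraicGeometry.Resolution
open Literature.AlgebraicGeometry.Resolution.CentreBlowup
open Literature.AlgebraicGeometry.Resolution.Hauser2010
open Literature.AlgebraicGeometry.Resolution.HauserPerlega2019

variable {K : Type} [Field K] [DecidableEq K]

/-- **THE ♯-VIRTUAL STEP FOR A REAL STEP OF ANY KIND, every prime** (module docstring). [OURS] [cite: Hauser2010, §§F–G]
[cite: CossartJannsenSaito2020, Thm. 3.14, Lemma 13.2] -/
theorem virtual_step_sharp_any_prime (p : ℕ) [Fact p.Prime] [CharP K p] {d c : ℕ} (hdp : d + 1 = p) (hc : c + 3 ≤ d)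
    {la mu u f : Fin 4} (hlm : la ≠ mu) (hlu : la ≠ u) (hlf : la ≠ f) (hmu : mu ≠ u) (hmf : mu ≠ f) (huf : u ≠ f)
    (hVT : ∀ (x y : Fin 4) (B : State K) (β : K), x ≠ y → x ≠ u → x ≠ f → y ≠ u → y ≠ f →
      ordZero B.F = ((d + 2 : ℕ) : ℕ∞) → (∀ e ∈ B.F.support, e f = c → 3 ≤ e x) →
      coeff (Finsupp.single x 4 + Finsupp.single y 3 + Finsupp.single u (d - 3 - c) + Finsupp.single f c) B.F = 0 →
      coeff (Finsupp.single x 3 + Finsupp.single y 3 + Finsupp.single u (d - 2 - c) + Finsupp.single f c) B.F ≠ 0 →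
      coeff (Finsupp.single x 3 + Finsupp.single y 3 + Finsupp.single u (d - 3 - c) + Finsupp.single f c)
        (CentreBlowup.step p Finset.univ x (Function.update (0 : Fin 4 → K) u β) B).F = 0 → β = 0)
    {π : Equiv.Perm (Fin 4)} {A B : State K} {M N Nc : ℕ}
    (hrel : ∃ (θ e : Fin 4 → MvPolynomial (Fin 4) K) (U E : MvPolynomial (Fin 4) K),
      θ (π la) = X la * e la ∧ θ (π mu) = X mu * e mu ∧ constantCoeff (e la) ≠ 0 ∧ constantCoeff (e mu) ≠ 0 ∧
      constantCoeff (θ (π u)) = 0 ∧ constantCoeff (θ (π f)) = 0 ∧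
      coeff (Finsupp.single u 1) (θ (π u)) * coeff (Finsupp.single f 1) (θ (π f)) -
        coeff (Finsupp.single f 1) (θ (π u)) * coeff (Finsupp.single u 1) (θ (π f)) ≠ 0 ∧
      constantCoeff U ≠ 0 ∧ E ∈ originIdeal K ^ M ∧ B.F = deletePthPowers p (U ^ p * aeval θ A.F) + E)
    (hrA : A.r = Finsupp.single (π la) 1 + Finsupp.single (π mu) 1) (hoA : ordZero A.F = ((d + 2 : ℕ) : ℕ∞))
    (hfr : ordZero B.F = ((d + 2 : ℕ) : ℕ∞) ∧ B.r = Finsupp.single la 1 + Finsupp.single mu 1 ∧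
      (∀ e ∈ B.F.support, B.r ≤ e) ∧ (∃ a : K, a ≠ 0 ∧ ResCone.resForm B = C a * X f ^ d) ∧
      (∀ e ∈ B.F.support, e.degree = d + 2 → e = Finsupp.single la 1 + Finsupp.single mu 1 + Finsupp.single u 0 + Finsupp.single f d) ∧
      (∀ e ∈ B.F.support, e f ≤ d - 1 → 2 ≤ e la ∧ 2 ≤ e mu) ∧
      (∀ e ∈ B.F.support, e f + 2 ≤ d → 3 ≤ e la) ∧ (∀ e ∈ B.F.support, e f + 2 ≤ d → 3 ≤ e mu) ∧
      (∀ E : Fin 4 →₀ ℕ, E.degree = d + 3 → E f + 2 ≤ d → coeff E B.F = 0) ∧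
      (∀ e ∈ B.F.support, e.degree < N → ¬ (e u = d - 3 - c ∧ e f = c)) ∧
      coeff (Finsupp.single la 3 + Finsupp.single mu 3 + Finsupp.single u (d - 2 - c) + Finsupp.single f c) B.F ≠ 0 ∧
      IsIsolated p B.F ∧ Module.finrank K (ResCone.resVertex B) = 3)
    -- the first real step
    {jr : Fin 4} {b : Fin 4 → K} (hbj : b jr = 0) {A' : State K} (hstep : A' = CentreBlowup.step p Finset.univ jr b A)
    (hisoA' : IsIsolated p A'.F) (hcert : originIdeal K ^ Nc ≤ singLocusIdeal p A'.F ⊔ originIdeal K ^ (Nc + 1))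
    (hoA' : ordZero A'.F = ((d + 2 : ℕ) : ℕ∞)) (he3A' : Module.finrank K (ResCone.resVertex A') = 3) (hw1 : ∀ k, A'.r k ≤ 1)
    (hdegA' : A'.r.degree = 2) (hdivA' : ∀ e ∈ A'.F.support, A'.r ≤ e)
    -- the second real step (look-ahead)
    {jr₂ : Fin 4} {b₂ : Fin 4 → K} (hbj₂ : b₂ jr₂ = 0) {A'' : State K} (hstep₂ : A'' = CentreBlowup.step p Finset.univ jr₂ b₂ A')
    (hisoA'' : IsIsolated p A''.F) (hcert'' : originIdeal K ^ Nc ≤ singLocusIdeal p A''.F ⊔ originIdeal K ^ (Nc + 1))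
    (hoA'' : ordZero A''.F = ((d + 2 : ℕ) : ℕ∞)) (he3A'' : Module.finrank K (ResCone.resVertex A'') = 3)
    (hw1'' : ∀ k, A''.r k ≤ 1) (hdegA'' : A''.r.degree = 2) (hdivA'' : ∀ e ∈ A''.F.support, A''.r ≤ e)
    (hM : Nc + 3 * p + 2 ≤ M) (hN : d + 5 ≤ N) :
    ∃ (ℓ : Fin 4) (π' : Equiv.Perm (Fin 4)), (ℓ = la ∨ ℓ = mu) ∧
      (ℓ = if jr = π la then la else if jr = π mu then mu else if b (π la) ≠ 0 then la else mu) ∧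
      (π' = if jr = π la ∨ jr = π mu then π else (Equiv.swap ℓ (π.symm jr)).trans π) ∧
      (∃ (θ' e' : Fin 4 → MvPolynomial (Fin 4) K) (U' E' : MvPolynomial (Fin 4) K),
        θ' (π' la) = X la * e' la ∧ θ' (π' mu) = X mu * e' mu ∧ constantCoeff (e' la) ≠ 0 ∧ constantCoeff (e' mu) ≠ 0 ∧
        constantCoeff (θ' (π' u)) = 0 ∧ constantCoeff (θ' (π' f)) = 0 ∧
        coeff (Finsupp.single u 1) (θ' (π' u)) * coeff (Finsupp.single f 1) (θ' (π' f)) -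
          coeff (Finsupp.single f 1) (θ' (π' u)) * coeff (Finsupp.single u 1) (θ' (π' f)) ≠ 0 ∧
        constantCoeff U' ≠ 0 ∧ E' ∈ originIdeal K ^ (M - p) ∧
        (CentreBlowup.step p Finset.univ ℓ 0 B).F = deletePthPowers p (U' ^ p * aeval θ' A'.F) + E') ∧
      A'.r = Finsupp.single (π' la) 1 + Finsupp.single (π' mu) 1 ∧
      (ordZero (CentreBlowup.step p Finset.univ ℓ 0 B).F = ((d + 2 : ℕ) : ℕ∞) ∧
        (CentreBlowup.step p Finset.univ ℓ 0 B).r = Finsupp.single la 1 + Finsupp.single mu 1 ∧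
        (∀ e ∈ (CentreBlowup.step p Finset.univ ℓ 0 B).F.support, (CentreBlowup.step p Finset.univ ℓ 0 B).r ≤ e) ∧
        (∃ a : K, a ≠ 0 ∧ ResCone.resForm (CentreBlowup.step p Finset.univ ℓ 0 B) = C a * X f ^ d) ∧
        (∀ e ∈ (CentreBlowup.step p Finset.univ ℓ 0 B).F.support, e.degree = d + 2 →
          e = Finsupp.single la 1 + Finsupp.single mu 1 + Finsupp.single u 0 + Finsupp.single f d) ∧
        (∀ e ∈ (CentreBlowup.step p Finset.univ ℓ 0 B).F.support, e f ≤ d - 1 → 2 ≤ e la ∧ 2 ≤ e mu) ∧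
        (∀ e ∈ (CentreBlowup.step p Finset.univ ℓ 0 B).F.support, e f + 2 ≤ d → 3 ≤ e la) ∧
        (∀ e ∈ (CentreBlowup.step p Finset.univ ℓ 0 B).F.support, e f + 2 ≤ d → 3 ≤ e mu) ∧
        (∀ E : Fin 4 →₀ ℕ, E.degree = d + 3 → E f + 2 ≤ d → coeff E (CentreBlowup.step p Finset.univ ℓ 0 B).F = 0) ∧
        (∀ e ∈ (CentreBlowup.step p Finset.univ ℓ 0 B).F.support, e.degree < N - d → ¬ (e u = d - 3 - c ∧ e f = c)) ∧
        coeff (Finsupp.single la 3 + Finsupp.single mu 3 + Finsupp.single u (d - 2 - c) + Finsupp.single f c)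
          (CentreBlowup.step p Finset.univ ℓ 0 B).F ≠ 0 ∧
        IsIsolated p (CentreBlowup.step p Finset.univ ℓ 0 B).F ∧
        Module.finrank K (ResCone.resVertex (CentreBlowup.step p Finset.univ ℓ 0 B)) = 3) := by
  obtain ⟨hoB, hrB, hdivB, ⟨a, ha, hformB⟩, hstrB, hledB, hRl, hRm, hlayerB, hrowB, hg, -, -⟩ := hfr
  have hdp2 : d + 2 = p + 1 := by omega
  have hoA1 : ordZero A.F = ((p + 1 : ℕ) : ℕ∞) := by rw [hoA, hdp2]
  have hoB1 : ordZero B.F = ((p + 1 : ℕ) : ℕ∞) := by rw [hoB, hdp2]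
  have hoA'1 : ordZero A'.F = ((p + 1 : ℕ) : ℕ∞) := by rw [hoA', hdp2]
  -- the swapped-orientation copies of the frame
  have hrBs : B.r = Finsupp.single mu 1 + Finsupp.single la 1 := by rw [hrB, add_comm]
  have hstrBs : ∀ e ∈ B.F.support, e.degree = d + 2 →
      e = Finsupp.single mu 1 + Finsupp.single la 1 + Finsupp.single u 0 + Finsupp.single f d :=
    fun e he hdeg => (hstrB e he hdeg).trans (ResCone.cone_comm mu la u f d)
  have hledBs : ∀ e ∈ B.F.support, e f ≤ d - 1 → 2 ≤ e mu ∧ 2 ≤ e la := fun e he hf => (hledB e he hf).symm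
  have hgs : coeff (Finsupp.single mu 3 + Finsupp.single la 3 + Finsupp.single u (d - 2 - c) + Finsupp.single f c) B.F ≠ 0 := by
    rw [add_comm (Finsupp.single mu 3) (Finsupp.single la 3)]; exact hg
  -- C♯: the translated shadow of the first real step
  obtain ⟨ℓ, π', b', hℓ, hℓeq, hπ'eq, hb'l, hb'm, hrel', hrA', ho', hr', -, hiso', he3'⟩ :=
    virtual_core_any_prime p hlm hlu hlf hmu hmf huf hrel hrA hoA1 hoB1 hrB hdivB hbj hstep hisoA' hcert hoA'1 he3A' hw1 hdegA' hdivA'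
      (by omega)
  rw [← hdp2] at ho'
  refine ⟨ℓ, π', hℓ, hℓeq, hπ'eq, ?_⟩
  rcases hℓ with rfl | rfl
  · -- virtual chart `λ`
    obtain ⟨hb'0, hfr'⟩ := virtual_step_sharp_of_core_prime p hdp hc hlm hlu hlf hmu hmf huf hVT hoB hrB hdivB ha hformB hstrB hledB
      hRl hRm hlayerB hN hrowB hg hb'l hb'm hrel' hrA' hoA' ho' he3' hiso' hbj₂ hstep₂ hisoA'' hcert'' hoA'' he3A'' hw1'' hdegA'' hdivA''
      (by omega)
    subst hb'0
    exact ⟨hrel', hrA', hfr'⟩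
  · -- virtual chart `μ`: the core statement in the letters `(μ, λ)`, read back
    obtain ⟨θ', e', U', E', h1, h2, h3, h4, h5, h6, h7, h8, h9, h10⟩ := hrel'
    have hrel's : ∃ (θ' e' : Fin 4 → MvPolynomial (Fin 4) K) (U' E' : MvPolynomial (Fin 4) K),
        θ' (π' ℓ) = X ℓ * e' ℓ ∧ θ' (π' la) = X la * e' la ∧ constantCoeff (e' ℓ) ≠ 0 ∧ constantCoeff (e' la) ≠ 0 ∧
        constantCoeff (θ' (π' u)) = 0 ∧ constantCoeff (θ' (π' f)) = 0 ∧
        coeff (Finsupp.single u 1) (θ' (π' u)) * coeff (Finsupp.single f 1) (θ' (π' f)) -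
          coeff (Finsupp.single f 1) (θ' (π' u)) * coeff (Finsupp.single u 1) (θ' (π' f)) ≠ 0 ∧
        constantCoeff U' ≠ 0 ∧ E' ∈ originIdeal K ^ (M - p) ∧
        (CentreBlowup.step p Finset.univ ℓ b' B).F = deletePthPowers p (U' ^ p * aeval θ' A'.F) + E' :=
      ⟨θ', e', U', E', h2, h1, h4, h3, h5, h6, h7, h8, h9, h10⟩
    have hrA's : A'.r = Finsupp.single (π' ℓ) 1 + Finsupp.single (π' la) 1 := by rw [hrA', add_comm]
    obtain ⟨hb'0, ho'', hr'', hdiv'', hform'', hstr'', hled'', hRm', hRl', hlayer'', hrow'', hg'', hiso'', he3''⟩ :=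
      virtual_step_sharp_of_core_prime p hdp hc hlm.symm hmu hmf hlu hlf huf hVT hoB hrBs hdivB ha hformB hstrBs hledBs hRm hRl hlayerB
        hN hrowB hgs hb'm hb'l hrel's hrA's hoA' ho' he3' hiso' hbj₂ hstep₂ hisoA'' hcert'' hoA'' he3A'' hw1'' hdegA'' hdivA'' (by omega)
    subst hb'0
    refine ⟨⟨θ', e', U', E', h1, h2, h3, h4, h5, h6, h7, h8, h9, h10⟩, hrA', ho'', by rw [hr'', add_comm], hdiv'', hform'',
      fun e he hdeg => (hstr'' e he hdeg).trans (ResCone.cone_comm la ℓ u f d), fun e he hf => (hled'' e he hf).symm, hRl', hRm',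
      hlayer'', hrow'', ?_, hiso'', he3''⟩
    rw [add_comm (Finsupp.single la 3) (Finsupp.single ℓ 3)]; exact hg''

end SwapTransport

end Summit.ResolutionOfSingularities.ResolutionOfSingularities.Theorems.PIDim4

end
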